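import Literature.NumberTheory.Automorphic.UnitaryGroupHyperbolicSwap
import Literature.NumberTheory.GelbartRogawski1991.LocalUnitaryIntegralLattice
import HarnessLib

/-!
# Integral points of `U(J)(F_v)` for a diagonal form of constant valuation: integrality ⇒ membership in `U(J)(𝒪_v)`

Topic `NumberTheory/Automorphic`; namespace `Literature.NumberTheory.Automorphic.UnitaryGroup`.  KERNEL ONLY: theorems,
no definition, no named fact, no `sorry`.  Sequel of `UnitaryGroupIsotropicLineElements` (root elements
`lineRoot`, dilations `lineDilation` of a hyperbolic pair [Dieudonne1971GroupesClassiques, Chap. II §5]) and of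
`GelbartRogawski1991/LocalUnitaryIntegralLattice` (integrality `IsIntegralLoc` over `E ⊗ F_v = ∏_{w ∣ v} E_w`, the integral
points `U(J)(𝒪_v) = localInt …` in factor form [PlatonovRapinchuk1994, §5.1]).

Setting: `E/F` quadratic, a finite place `v` of `F`, the local Gram matrix `J_v = (J ⊗ 1)_v` of `U(J)(F_v) = «local» E c N J v`.

* §1 bookkeeping at `v`: `|a|_v ≤ 1 ↔ v(a) ≤ 1`, `|a|_v = |b|_v → v(a) = v(b)`, `|2|_v = 1 → v ∤ 2`, integrality of `ι_v(a)`
  (`|a|_v ≤ 1`), of `1`, of `δ ⊗ 1` when `d = δ²` is a `v`-unit; the local Gram matrix of a DIAGONAL rational form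
  `T = diagonal tD` is `diagonal (ι_v (tD i))` (`localGram_eq_diagonal`); the pairing `h`, the row `h(x, ·)`, and the ENTRIES
  of the transvections `lineRoot σ H x 0 z` and of the dilations `lineDilation σ H x y α β` for a diagonal `H`.
* §2 **integrality ⇒ membership** (`localPiEquiv_symm_mem_localInt_of_isIntegralLoc`): if `J_v = diagonal (ι_v t)` with ALL
  `t i` of the same valuation, an element `g ∈ U(J)(F_v)` whose matrix over `E ⊗ F_v` is integral has an integral inverse
  (`J_v g⁻¹ = (σ g)ᵀ J_v`, so `ι(t_i) (g⁻¹)_{ij} = σ(g_{ji}) ι(t_j)` with `|t_i|_v = |t_j|_v ≠ 0`;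
  `isIntegralLoc_inv_of_localGram_eq_diagonal`), hence lies in `U(J)(𝒪_v)` (`localPiEquiv_symm_mem_localInt`: integral matrix
  and integral inverse ⇒ every `w`-component in `GL_N(𝒪_w)`).

Written for the cell hodgecm-mathlib (ROAD δ of the NSI closer; feeder of `UnitaryGroupIntegralRootData`, the δ2-A letter).
HC_CM is proved only modulo the printed citations until rung 0 closes.

## References
* [Dieudonne1971GroupesClassiques] J. Dieudonné, *La géométrie des groupes classiques*, 3e éd. (1971), Chap. II §5.
* [PlatonovRapinchuk1994] V. Platonov, A. Rapinchuk, *Algebraic Groups and Number Theory* (1994), §5.1.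
* [CasselsFrohlichANT1967] J. W. S. Cassels, A. Fröhlich (eds.), *Algebraic Number Theory* (1967), Ch. II §10.
-/

set_option autoImplicit false

noncomputable section

open NumberField IsDedekindDomain Matrix
open scoped NNReal
open Literature.NumberTheory.Automorphic Literature.NumberTheory.Automorphic.UnitaryGroup
open Literature.NumberTheory.GaloisRepresentations.IsNonarchimedeanLocalField
open Literature.NumberTheory.GelbartRogawski1991.UnitaryDualPair.LocalSplitting

namespace Literature.NumberTheory.Automorphic.UnitaryGroup

/-! ## §1 Bookkeeping at `v`: `|·|_v`, `Valued.v`, integrality of scalars, the diagonal local Gram matrix -/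

section Bookkeeping

variable {F : Type} [Field F] [NumberField F] (E : Type) [Field E] [NumberField E] [Algebra F E]
  (v : HeightOneSpectrum (𝓞 F))

omit [NumberField E] [Algebra F E] in
/-- `|a|_v ≤ 1 ↔ v(a) ≤ 1` on `F_v`. [cite: CasselsFrohlichANT1967, Ch. II §10] -/
theorem normAbs_le_one_iff_valued (a : v.adicCompletion F) :
    normAbs (v.adicCompletion F) a ≤ 1 ↔ Valued.v a ≤ 1 := by
  rw [← mem_primePowBall_zero_iff_valued F v a, mem_primePowBall_iff, zpow_zero]

omit [NumberField E] [Algebra F E] in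
/-- `|a|_v = |b|_v → v(a) = v(b)` on `F_v`. [cite: CasselsFrohlichANT1967, Ch. II §10] -/
theorem valued_eq_of_normAbs_eq {a b : v.adicCompletion F}
    (h : normAbs (v.adicCompletion F) a = normAbs (v.adicCompletion F) b) : Valued.v a = Valued.v b :=
  le_antisymm ((normAbs_le_normAbs_iff_valued v a b).1 h.le) ((normAbs_le_normAbs_iff_valued v b a).1 h.ge)

omit [NumberField E] [Algebra F E] in
/-- `|a|_v = 1 → v(a) = 1` on `F_v`. [cite: CasselsFrohlichANT1967, Ch. II §10] -/
theorem valued_eq_one_of_normAbs_eq_one {a : v.adicCompletion F} (h : normAbs (v.adicCompletion F) a = 1) :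
    Valued.v a = 1 := by
  have h1 := valued_eq_of_normAbs_eq v (h.trans (map_one (normAbs (v.adicCompletion F))).symm)
  rwa [map_one] at h1

omit [NumberField E] [Algebra F E] in
/-- `|2|_v = 1` means `v ∤ 2` (`2 ∉ v`). [cite: CasselsFrohlichANT1967, Ch. II §10] -/
theorem two_not_mem_of_normAbs_two (h2 : normAbs (v.adicCompletion F) (2 : v.adicCompletion F) = 1) :
    (2 : 𝓞 F) ∉ v.asIdeal := by
  have hv : Valued.v (2 : v.adicCompletion F) = 1 := valued_eq_one_of_normAbs_eq_one v h2
  have h : (2 : v.adicCompletion F) = algebraMap F (v.adicCompletion F) (algebraMap (𝓞 F) F 2) := by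
    rw [map_ofNat, map_ofNat]
  rw [h] at hv
  have hval : Valued.v (algebraMap F (v.adicCompletion F) (algebraMap (𝓞 F) F 2)) =
      v.valuation F (algebraMap (𝓞 F) F 2) := HeightOneSpectrum.valuedAdicCompletion_eq_valuation' v _
  rw [hval] at hv
  exact (HeightOneSpectrum.valuation_eq_one_iff_notMem v).1 hv

/-- `ι_v(a)` is integral when `|a|_v ≤ 1`. [cite: CasselsFrohlichANT1967, Ch. II §10] -/
theorem isIntegralLoc_toLocalRing_of_normAbs_le {a : v.adicCompletion F} (ha : normAbs (v.adicCompletion F) a ≤ 1) :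
    IsIntegralLoc F E v (toLocalRing E v a) :=
  (isIntegralLoc_toLocalRing_iff F E v a).2 ((normAbs_le_one_iff_valued v a).1 ha)

omit [NumberField F] in
/-- `1 ∈ E ⊗ F_v` is integral. [cite: CasselsFrohlichANT1967, Ch. II §10] -/
theorem isIntegralLoc_one : IsIntegralLoc F E v (1 : LocalRing E v) := fun w => by
  rw [Pi.one_apply, map_one]

omit [NumberField F] in
/-- entries of the identity matrix are integral. [cite: CasselsFrohlichANT1967, Ch. II §10] -/
theorem isIntegralLoc_one_apply {N : ℕ} (i j : Fin N) : IsIntegralLoc F E v ((1 : Matrix (Fin N) (Fin N) (LocalRing E v)) i j) := by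
  rw [Matrix.one_apply]
  split_ifs
  · exact isIntegralLoc_one E v
  · exact IsIntegralLoc.zero

/-- **`δ ⊗ 1` is integral at a place where `d = δ²` is a unit.** [cite: CasselsFrohlichANT1967, Ch. II §10] -/
theorem isIntegralLoc_delta {δ : E} {d : F} (hd : δ * δ = algebraMap F E d)
    (hdv : normAbs (v.adicCompletion F) (algebraMap F (v.adicCompletion F) d) = 1) :
    IsIntegralLoc F E v (algebraMap E (LocalRing E v) δ) := by
  have hdv1 : Valued.v (algebraMap F (v.adicCompletion F) d) = 1 := valued_eq_one_of_normAbs_eq_one v hdv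
  intro w
  rw [valuation_le_one_iff_valued]
  have hδδ : algebraMap E (LocalRing E v) δ * algebraMap E (LocalRing E v) δ =
      toLocalRing E v (algebraMap F (v.adicCompletion F) d) := by
    rw [← map_mul, hd]
    exact (toLocalRing_coe E v d).symm
  have hsq : (algebraMap E (LocalRing E v) δ w) * (algebraMap E (LocalRing E v) δ w) =
      toPlace v w (algebraMap F (v.adicCompletion F) d) := by
    rw [← Pi.mul_apply, hδδ, toLocalRing_apply]
  have h1 : Valued.v (algebraMap E (LocalRing E v) δ w) ^ 2 = 1 := by
    rw [sq, ← map_mul, hsq, valued_toPlace, hdv1, one_pow]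
  exact (pow_le_one_iff two_ne_zero).1 h1.le

omit [NumberField F] in
/-- the local Gram matrix of `J = T ⊗ 1` is `J` pushed to `E ⊗ F_v` (definitional). [cite: PlatonovRapinchuk1994, §5.1] -/
theorem localGram_eq_map {N : ℕ} (J : Matrix (Fin N) (Fin N) E) :
    (adelicForm E N J).map (adeleToLocal E v) = J.map (algebraMap E (LocalRing E v)) := by
  rw [adelicForm, Matrix.map_map]
  rfl

/-- **the local Gram matrix of a DIAGONAL rational form is `diagonal (ι_v (tD i))`.** [cite: PlatonovRapinchuk1994, §5.1] -/
theorem localGram_eq_diagonal {N : ℕ} {J : Matrix (Fin N) (Fin N) E} {T : Matrix (Fin N) (Fin N) F}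
    (hJ : J = T.map (algebraMap F E)) {tD : Fin N → F} (hTD : T = Matrix.diagonal tD) :
    (adelicForm E N J).map (adeleToLocal E v) =
      Matrix.diagonal fun i => toLocalRing E v (algebraMap F (v.adicCompletion F) (tD i)) := by
  rw [localGram_eq_map, hJ, hTD, Matrix.diagonal_map (map_zero _), Matrix.diagonal_map (map_zero _)]
  congr 1
  funext i
  rw [← toLocalRing_coe]
  rfl

omit [NumberField F] in
/-- the pairing of a diagonal Gram matrix: `h(x, y) = Σ σ(x_i) t_i y_i`. [cite: Dieudonne1971GroupesClassiques, Chap. II §5] -/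
theorem hermForm_diagonal_apply {N : ℕ} (σ : LocalRing E v →+* LocalRing E v) (t x y : Fin N → LocalRing E v) :
    hermForm σ (Matrix.diagonal t) x y = ∑ i, σ (x i) * (t i * y i) := by
  rw [hermForm_apply]
  simp only [dotProduct, Function.comp_apply, Matrix.mulVec_diagonal]

omit [NumberField F] in
/-- the pairing of a diagonal Gram matrix on a vector supported on `{i₁, i₂}`: two terms.
[cite: Dieudonne1971GroupesClassiques, Chap. II §5] -/
theorem hermForm_diagonal_of_support_pair {N : ℕ} (σ : LocalRing E v →+* LocalRing E v) (t x y : Fin N → LocalRing E v)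
    {i₁ i₂ : Fin N} (hi : i₁ ≠ i₂) (hx : ∀ k, k ≠ i₁ → k ≠ i₂ → x k = 0) :
    hermForm σ (Matrix.diagonal t) x y = σ (x i₁) * (t i₁ * y i₁) + σ (x i₂) * (t i₂ * y i₂) := by
  rw [hermForm_diagonal_apply]
  exact Fintype.sum_eq_add i₁ i₂ hi fun k hk => by rw [hx k hk.1 hk.2, map_zero, zero_mul]

omit [NumberField F] in
/-- the row `h(x, ·)` of a diagonal Gram matrix: `(hermRow x)_j = σ(x_j) t_j`. [cite: Dieudonne1971GroupesClassiques, Chap. II §5] -/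
theorem hermRow_diagonal_apply {N : ℕ} (σ : LocalRing E v →+* LocalRing E v) (t x : Fin N → LocalRing E v) (j : Fin N) :
    hermRow σ (Matrix.diagonal t) x j = σ (x j) * t j := by
  rw [hermRow, Matrix.vecMul_diagonal, Function.comp_apply]

omit [NumberField F] in
/-- entries of the transvection `n_z(x) = lineRoot σ H x 0 z` for a diagonal `H`: `δ_{ij} + x_i z σ(x_j) t_j`.
[cite: Dieudonne1971GroupesClassiques, Chap. II §5] -/
theorem lineRoot_zero_diagonal_apply {N : ℕ} (σ : LocalRing E v →+* LocalRing E v) (t x : Fin N → LocalRing E v)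
    (z : LocalRing E v) (i j : Fin N) :
    lineRoot σ (Matrix.diagonal t) x 0 z i j = (1 : Matrix (Fin N) (Fin N) (LocalRing E v)) i j + x i * (z * (σ (x j) * t j)) := by
  simp only [lineRoot, hermRow_zero, Matrix.add_apply, Matrix.vecMulVec_apply, Pi.zero_apply, zero_mul, add_zero, sub_zero,
    Pi.smul_apply, smul_eq_mul, hermRow_diagonal_apply]

omit [NumberField F] in
/-- entries of the dilation `D(α, β) = lineDilation σ H x y α β` for a diagonal `H`:
`δ_{ij} + x_i (α−1) σ(y_j) t_j + y_i (β−1) σ(x_j) t_j`. [cite: Dieudonne1971GroupesClassiques, Chap. II §5] -/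
theorem lineDilation_diagonal_apply {N : ℕ} (σ : LocalRing E v →+* LocalRing E v) (t x y : Fin N → LocalRing E v)
    (α β : LocalRing E v) (i j : Fin N) :
    lineDilation σ (Matrix.diagonal t) x y α β i j =
      (1 : Matrix (Fin N) (Fin N) (LocalRing E v)) i j + x i * ((α - 1) * (σ (y j) * t j)) + y i * ((β - 1) * (σ (x j) * t j)) := by
  simp only [lineDilation, Matrix.add_apply, Matrix.vecMulVec_apply, Pi.smul_apply, smul_eq_mul, hermRow_diagonal_apply]

end Bookkeeping

/-! ## §2 Integrality ⇒ membership in `U(J)(𝒪_v)` for a diagonal form of constant valuation -/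

section Membership

variable {F : Type} [Field F] [NumberField F] (E : Type) [Field E] [NumberField E] [Algebra F E]
  (c : E ≃ₐ[F] E) (N : ℕ) (J : Matrix (Fin N) (Fin N) E) (v : HeightOneSpectrum (𝓞 F))

/-- **integral matrix and integral inverse ⇒ `U(J)(𝒪_v)`**: if `g ∈ U(J)(F_v)` and both `g` and `g⁻¹` have integral entries over
`E ⊗ F_v`, then (in factor form) `g ∈ U(J)(𝒪_v) = U(J)(F_v) ∩ ∏_w GL_N(𝒪_w)`. [cite: PlatonovRapinchuk1994, §5.1] -/
theorem localPiEquiv_symm_mem_localInt (g : «local» E c N J v)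
    (hg : ∀ i j, IsIntegralLoc F E v ((g : GL (Fin N) (LocalRing E v)).val i j))
    (hg' : ∀ i j, IsIntegralLoc F E v (((g⁻¹ : «local» E c N J v) : GL (Fin N) (LocalRing E v)).val i j)) :
    (localPiEquiv E c N J v).symm g ∈ localInt E c N J v := by
  rw [mem_localInt_iff]
  intro w
  rw [mem_glInt_iff]
  have hmat : ∀ g' : «local» E c N J v, matLoc F E c v N ((localPiEquiv E c N J v).symm g') =
      (g' : GL (Fin N) (LocalRing E v)).val := fun g' => by
    rw [matLoc, ContinuousMulEquiv.apply_symm_apply]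
  constructor
  · intro i j
    rw [Valuation.mem_integer_iff, ← matLoc_apply F E c v N, hmat]
    exact hg i j w
  · intro i j
    have hinv : ((((localPiEquiv E c N J v).symm g : localPi E c N J v) : LocalGLPi E N v) w)⁻¹ =
        ((((localPiEquiv E c N J v).symm g⁻¹ : localPi E c N J v) : LocalGLPi E N v) w) := by
      rw [map_inv, Subgroup.coe_inv, Pi.inv_apply]
    rw [hinv, Valuation.mem_integer_iff, ← matLoc_apply F E c v N, hmat]
    exact hg' i j w

/-- **for `J_v = diagonal (ι_v t)` of CONSTANT valuation, a unitary `g` with integral matrix has an integral inverse**: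
`J_v g⁻¹ = (σ g)ᵀ J_v`, so `ι(t_i) (g⁻¹)_{ij} = σ(g_{ji}) ι(t_j)` with `|t_i|_v = |t_j|_v ≠ 0`.
[cite: Dieudonne1971GroupesClassiques, Chap. II §5] [cite: PlatonovRapinchuk1994, §5.1] -/
theorem isIntegralLoc_inv_of_localGram_eq_diagonal {t : Fin N → v.adicCompletion F} (ht0 : ∀ i, t i ≠ 0)
    (ht : ∀ i j, Valued.v (t i) = Valued.v (t j))
    (hJv : (adelicForm E N J).map (adeleToLocal E v) = Matrix.diagonal fun i => toLocalRing E v (t i))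
    (g : «local» E c N J v) (hg : ∀ i j, IsIntegralLoc F E v ((g : GL (Fin N) (LocalRing E v)).val i j)) (i j : Fin N) :
    IsIntegralLoc F E v (((g⁻¹ : «local» E c N J v) : GL (Fin N) (LocalRing E v)).val i j) := by
  have hU := (mem_unitaryGroupOfForm_iff.1 g.2)
  have hmul : (g : GL (Fin N) (LocalRing E v)).val * ((g : GL (Fin N) (LocalRing E v))⁻¹).val = 1 := Units.mul_inv _
  have hcoe : ((g⁻¹ : «local» E c N J v) : GL (Fin N) (LocalRing E v)) = (g : GL (Fin N) (LocalRing E v))⁻¹ := rfl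
  have key : (adelicForm E N J).map (adeleToLocal E v) * ((g : GL (Fin N) (LocalRing E v))⁻¹).val =
      ((g : GL (Fin N) (LocalRing E v)).val.map (conjLocal E c v))ᵀ * (adelicForm E N J).map (adeleToLocal E v) := by
    calc (adelicForm E N J).map (adeleToLocal E v) * ((g : GL (Fin N) (LocalRing E v))⁻¹).val
        = (((g : GL (Fin N) (LocalRing E v)).val.map (conjLocal E c v))ᵀ * (adelicForm E N J).map (adeleToLocal E v) *
            (g : GL (Fin N) (LocalRing E v)).val) * ((g : GL (Fin N) (LocalRing E v))⁻¹).val := by rw [hU]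
      _ = ((g : GL (Fin N) (LocalRing E v)).val.map (conjLocal E c v))ᵀ * (adelicForm E N J).map (adeleToLocal E v) *
            ((g : GL (Fin N) (LocalRing E v)).val * ((g : GL (Fin N) (LocalRing E v))⁻¹).val) := by
          simp only [Matrix.mul_assoc]
      _ = ((g : GL (Fin N) (LocalRing E v)).val.map (conjLocal E c v))ᵀ * (adelicForm E N J).map (adeleToLocal E v) := by
          rw [hmul, Matrix.mul_one]
  have hij := congrFun (congrFun key i) j
  rw [hJv, Matrix.diagonal_mul, Matrix.mul_diagonal, Matrix.transpose_apply, Matrix.map_apply] at hij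
  -- `hij : ι(t i) * (g⁻¹)_{ij} = σ(g_{ji}) * ι(t j)`
  rw [hcoe]
  intro w
  have hw := congrArg (fun x : LocalRing E v => Valued.v (x w)) hij
  simp only [Pi.mul_apply, map_mul, toLocalRing_apply, valued_toPlace] at hw
  have hσ : Valued.v ((conjLocal E c v ((g : GL (Fin N) (LocalRing E v)).val j i)) w) ≤ 1 :=
    (valuation_le_one_iff_valued E w.1 _).1 (((hg j i).conj c) w)
  have hτ0 : Valued.v (t j) ^ v.asIdeal.ramificationIdx' w.1.asIdeal ≠ 0 :=
    pow_ne_zero _ ((Valuation.ne_zero_iff _).2 (ht0 j))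
  rw [ht i j] at hw
  rw [valuation_le_one_iff_valued]
  calc Valued.v (((g : GL (Fin N) (LocalRing E v))⁻¹).val i j w)
      = (Valued.v (t j) ^ v.asIdeal.ramificationIdx' w.1.asIdeal)⁻¹ *
          (Valued.v (t j) ^ v.asIdeal.ramificationIdx' w.1.asIdeal *
            Valued.v (((g : GL (Fin N) (LocalRing E v))⁻¹).val i j w)) := by
        rw [← mul_assoc, inv_mul_cancel₀ hτ0, one_mul]
    _ = (Valued.v (t j) ^ v.asIdeal.ramificationIdx' w.1.asIdeal)⁻¹ *
          (Valued.v ((conjLocal E c v ((g : GL (Fin N) (LocalRing E v)).val j i)) w) *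
            Valued.v (t j) ^ v.asIdeal.ramificationIdx' w.1.asIdeal) := by rw [hw]
    _ ≤ (Valued.v (t j) ^ v.asIdeal.ramificationIdx' w.1.asIdeal)⁻¹ *
          (1 * Valued.v (t j) ^ v.asIdeal.ramificationIdx' w.1.asIdeal) :=
        mul_le_mul' le_rfl (mul_le_mul' hσ le_rfl)
    _ = 1 := by rw [one_mul, inv_mul_cancel₀ hτ0]

/-- **integrality ⇒ `U(J)(𝒪_v)`** for a diagonal Gram matrix of constant valuation: an element of `U(J)(F_v)` with integral
matrix over `E ⊗ F_v` lies in `U(J)(𝒪_v)` (factor form). [cite: PlatonovRapinchuk1994, §5.1] -/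
theorem localPiEquiv_symm_mem_localInt_of_isIntegralLoc {t : Fin N → v.adicCompletion F} (ht0 : ∀ i, t i ≠ 0)
    (ht : ∀ i j, Valued.v (t i) = Valued.v (t j))
    (hJv : (adelicForm E N J).map (adeleToLocal E v) = Matrix.diagonal fun i => toLocalRing E v (t i))
    (g : «local» E c N J v) (hg : ∀ i j, IsIntegralLoc F E v ((g : GL (Fin N) (LocalRing E v)).val i j)) :
    (localPiEquiv E c N J v).symm g ∈ localInt E c N J v :=
  localPiEquiv_symm_mem_localInt E c N J v g hg (isIntegralLoc_inv_of_localGram_eq_diagonal E c N J v ht0 ht hJv g hg)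

end Membership


end Literature.NumberTheory.Automorphic.UnitaryGroup

end
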